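import Mathlib
import Summits.MatrixMultiplication.MatrixMultiplication.Theorems.SnSubsetDichotomyHyperoctahedralThresholdStubPatternTwin
import Summits.MatrixMultiplication.MatrixMultiplication.Theorems.SnSubsetDichotomyHyperoctahedralThresholdRotationIdentity

/-!
# The twins ℓ² reduction in BULK form: a counted family of clean twin walks with bounded point-degree
(crux `SnSubsetDichotomy.HyperoctahedralThreshold`, stmt-MatrixMultiplication-10883; siege seat k18, variation "twins ℓ² argument";
`--supports` helper, third file — the bridge from the twin counts of `…TwinDefects` / `…TwinsEll2` to branch (B) of the
alternative line `Lines/one-scale-dichotomy.lean`, stub `stub_oneScaleDichotomy`)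

Vocabulary as in `…TwinDefects`: involutions `μ c` of `Fin n`, `x · z := z.foldl (fun v c => μ c v) x`, cyclically reduced words of
length `ℓ` as the filtered image of `List.Vector (Fin 3) ℓ`; counts at length `ℓ = k + 2`:
`Pairs := #{(z, x, y) : x ≠ y both fixed by z}`, `S₁` (returns × other fixed points), `Ξ` (slides), and the PAIR DEGREE
`Dp ≥ max_v #{(z, y) : (z, v, y) ∈ Pairs}` (the dense-vertex parameter; no forbidden set in the bulk form).

`stub_twinsEll2BulkInc` (incidence form; with `selfInc_le`, `crossInc_le` of `…TwinDefects`, p114598, it gives the registered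
`stub_twinsEll2Bulk` with `(k+2)·(2 S₁ + Ξ)` in place of `2·#SELF + #CROSS` — a two-line composition left to a file that can import both):
if  `2·#SELF + #CROSS + 2(k+2)·(2(k+2)·Dp)·G < Pairs`  then there is a finset `W` of clean closed rung-walk
data `(col, p, q)` on `Fin (k + 2)` — exactly the clause format of branch (B) of `stub_oneScaleDichotomy` (distinct rung ends, steps as
sets, cyclically non-repeating colours, pairwise equal-or-disjoint rungs) — with point-degree `≤ D := 2(k+2)·Dp` and
`2(k+2)·D·G < |W|`.  Proof: GOOD twin pre-pairs (both trajectories simple, never crossing) number `≥ Pairs − 2·#SELF − #CROSS`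
(SELF / CROSS incidences as in `…TwinDefects`, plus the mirror image of SELF); `W` is their injective image under
`(z; x, y) ↦ (t ↦ z[t], t ↦ x · z.take t, t ↦ y · z.take t)`; a vertex `v` lies on the walk of `(z; x, y)` only through an incidence
`x · z.take i = v` or `y · z.take i = v`, and rotating by `i` files these injectively under `range (k+2) ×` the pre-pairs based at `v`.
So the altline's atom reduces, at any one scale, to the same counted inequality as the live line's core (without the `R`-term), with
the dense-vertex quantity explicit.  Pure finite combinatorics; hypothesis `μ c * μ c = 1` only; no definitions.
-/

set_option linter.dupNamespace false

namespace Summit.MatrixMultiplication.MatrixMultiplication.Theorems.HyperoctahedralThreshold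

namespace TwinsEll2

open Finset Rotation

variable {n : ℕ}

/-- The explicit clean-walk data of a good twin pre-pair `(z; x, y)` of length `k + 2`: colours `t ↦ z[t]`, sides
`t ↦ x · z.take t` and `t ↦ y · z.take t`.  (Total in `z` via `List.getD`.) -/
theorem walkData_clauses (μ : Fin 3 → Equiv.Perm (Fin n)) {k : ℕ} {z : List (Fin 3)} (hzl : z.length = k + 2)
    (hchain : List.IsChain (· ≠ ·) (z ++ z)) {x y : Fin n}
    (hx : z.foldl (fun v c => μ c v) x = x) (hy : z.foldl (fun v c => μ c v) y = y)
    (hsx : ∀ s < z.length, ∀ t < z.length,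
      (z.take s).foldl (fun v c => μ c v) x = (z.take t).foldl (fun v c => μ c v) x → s = t)
    (hsy : ∀ s < z.length, ∀ t < z.length,
      (z.take s).foldl (fun v c => μ c v) y = (z.take t).foldl (fun v c => μ c v) y → s = t)
    (hcross : ∀ s < z.length, ∀ t < z.length,
      (z.take s).foldl (fun v c => μ c v) x ≠ (z.take t).foldl (fun v c => μ c v) y) :
    let w : (Fin (k + 2) → Fin 3) × (Fin (k + 2) → Fin n) × (Fin (k + 2) → Fin n) :=
      (fun i => z.getD i 0, fun i => (z.take i).foldl (fun v c => μ c v) x, fun i => (z.take i).foldl (fun v c => μ c v) y)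
    (∀ i, w.2.1 i ≠ w.2.2 i) ∧
      (∀ i, (μ (w.1 i) (w.2.1 i) = w.2.1 (i + 1) ∧ μ (w.1 i) (w.2.2 i) = w.2.2 (i + 1)) ∨
        (μ (w.1 i) (w.2.1 i) = w.2.2 (i + 1) ∧ μ (w.1 i) (w.2.2 i) = w.2.1 (i + 1))) ∧
      (∀ i, w.1 i ≠ w.1 (i + 1)) ∧
      (∀ i j, (w.2.1 i = w.2.1 j ∧ w.2.2 i = w.2.2 j) ∨ (w.2.1 i = w.2.2 j ∧ w.2.2 i = w.2.1 j) ∨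
        (w.2.1 i ≠ w.2.1 j ∧ w.2.1 i ≠ w.2.2 j ∧ w.2.2 i ≠ w.2.1 j ∧ w.2.2 i ≠ w.2.2 j)) := by
  intro w
  have hlt : ∀ i : Fin (k + 2), (i : ℕ) < z.length := fun i => i.isLt.trans_eq hzl.symm
  have hval : ∀ i : Fin (k + 2), ((i + 1 : Fin (k + 2)) : ℕ) = ((i : ℕ) + 1) % z.length := fun i => by
    rw [PatternTwin.val_add_one, hzl]
  have hcol : ∀ i : Fin (k + 2), w.1 i = z[(i : ℕ)]'(hlt i) := fun i => List.getD_eq_getElem z 0 (hlt i)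
  refine ⟨?_, ?_, ?_, ?_⟩
  · intro i
    exact hcross i (hlt i) i (hlt i)
  · intro i
    refine Or.inl ⟨?_, ?_⟩
    · show μ (w.1 i) ((z.take i).foldl (fun v c => μ c v) x) =
        (z.take ((i + 1 : Fin (k + 2)) : ℕ)).foldl (fun v c => μ c v) x
      rw [hcol i, hval i]
      exact GoodTwin.foldl_take_step μ z x hx i (hlt i)
    · show μ (w.1 i) ((z.take i).foldl (fun v c => μ c v) y) =
        (z.take ((i + 1 : Fin (k + 2)) : ℕ)).foldl (fun v c => μ c v) y
      rw [hcol i, hval i]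
      exact GoodTwin.foldl_take_step μ z y hy i (hlt i)
  · intro i
    rw [hcol i, hcol (i + 1)]
    exact GoodTwin.cyclic_ne hchain i _ (hlt i) (hlt (i + 1)) (hval i)
  · intro i j
    by_cases hij : i = j
    · subst hij
      exact Or.inl ⟨rfl, rfl⟩
    · have hij' : (i : ℕ) ≠ (j : ℕ) := fun h => hij (Fin.ext h)
      refine Or.inr (Or.inr ⟨fun h => hij' (hsx i (hlt i) j (hlt j) h), hcross i (hlt i) j (hlt j),
        fun h => hcross j (hlt j) i (hlt i) h.symm, fun h => hij' (hsy i (hlt i) j (hlt j) h)⟩)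

/-- **Incidences of twin pre-pairs at a vertex are `ℓ ×` the pre-pairs based there.**  For a vertex `v`, the tuples
`(z, x, y, i)` with `x ≠ y` fixed by `z` (cyclically reduced, length `ℓ`), `i < ℓ` and `x · z.take i = v` OR `y · z.take i = v`
number at most `2 ℓ ×` the pre-pairs `(z', v, u)` based at `v`: rotate by `i` and record the other point. -/
theorem card_through_le (μ : Fin 3 → Equiv.Perm (Fin n)) (hμ : ∀ c, μ c * μ c = 1) (ℓ : ℕ) (v : Fin n) :
    (((((univ : Finset (List.Vector (Fin 3) ℓ)).image (fun v => v.toList)).filter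
        (fun z => List.IsChain (· ≠ ·) (z ++ z))) ×ˢ (univ : Finset (Fin n)) ×ˢ (univ : Finset (Fin n)) ×ˢ
        range ℓ).filter (fun t =>
          t.1.foldl (fun v c => μ c v) t.2.1 = t.2.1 ∧ t.1.foldl (fun v c => μ c v) t.2.2.1 = t.2.2.1 ∧
          t.2.1 ≠ t.2.2.1 ∧ ((t.1.take t.2.2.2).foldl (fun v c => μ c v) t.2.1 = v ∨
            (t.1.take t.2.2.2).foldl (fun v c => μ c v) t.2.2.1 = v))).card ≤
      2 * (ℓ * (((((univ : Finset (List.Vector (Fin 3) ℓ)).image (fun v => v.toList)).filter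
        (fun z => List.IsChain (· ≠ ·) (z ++ z))) ×ˢ (univ : Finset (Fin n))).filter (fun t =>
          t.1.foldl (fun v c => μ c v) v = v ∧ t.1.foldl (fun v c => μ c v) t.2 = t.2 ∧ v ≠ t.2)).card) := by
  classical
  set Wd := ((univ : Finset (List.Vector (Fin 3) ℓ)).image (fun v => v.toList)).filter
    (fun z => List.IsChain (· ≠ ·) (z ++ z)) with hWd
  set Pv := (Wd ×ˢ (univ : Finset (Fin n))).filter (fun t =>
    t.1.foldl (fun v c => μ c v) v = v ∧ t.1.foldl (fun v c => μ c v) t.2 = t.2 ∧ v ≠ t.2) with hPv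
  set A := (Wd ×ˢ (univ : Finset (Fin n)) ×ˢ (univ : Finset (Fin n)) ×ˢ range ℓ).filter (fun t =>
    t.1.foldl (fun v c => μ c v) t.2.1 = t.2.1 ∧ t.1.foldl (fun v c => μ c v) t.2.2.1 = t.2.2.1 ∧
    t.2.1 ≠ t.2.2.1 ∧ ((t.1.take t.2.2.2).foldl (fun v c => μ c v) t.2.1 = v ∨
      (t.1.take t.2.2.2).foldl (fun v c => μ c v) t.2.2.1 = v)) with hA
  -- split by which side passes through `v`
  set Ax := A.filter (fun t => (t.1.take t.2.2.2).foldl (fun v c => μ c v) t.2.1 = v) with hAx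
  set Ay := A.filter (fun t => (t.1.take t.2.2.2).foldl (fun v c => μ c v) t.2.2.1 = v) with hAy
  have hsplit : A ⊆ Ax ∪ Ay := by
    intro t ht
    have h := ht
    rw [hA, mem_filter] at h
    rcases h.2.2.2.2 with h1 | h1
    · refine mem_union.2 (Or.inl ?_)
      rw [hAx, mem_filter]
      exact ⟨ht, h1⟩
    · refine mem_union.2 (Or.inr ?_)
      rw [hAy, mem_filter]
      exact ⟨ht, h1⟩
  have hcardPv : (range ℓ ×ˢ Pv).card = ℓ * Pv.card := by rw [card_product, card_range]
  -- the `x`-side: `(z, x, y, i) ↦ (i, z.rotate i, y · z.take i)`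
  have hx : Ax.card ≤ ℓ * Pv.card := by
    rw [← hcardPv]
    refine card_le_card_of_injOn
      (fun t => (t.2.2.2, t.1.rotate t.2.2.2, (t.1.take t.2.2.2).foldl (fun v c => μ c v) t.2.2.1)) ?_ ?_
    · rintro ⟨z, x, y, i⟩ h
      rw [mem_coe, hAx, mem_filter, hA, mem_filter] at h
      obtain ⟨⟨hmem, hxf, hyf, hxy, -⟩, hv⟩ := h
      simp only [mem_product, mem_univ, true_and, mem_range] at hmem
      obtain ⟨hz, hi⟩ := hmem
      dsimp only at hxf hyf hxy hv hz hi
      have hzl : z.length = ℓ := (mem_cycWords.1 hz).1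
      simp only
      rw [mem_coe, mem_product, hPv, mem_filter]
      simp only [mem_product, mem_univ, and_true, mem_range]
      refine ⟨hi, rotate_mem_cycWords hz i, ?_, (foldl_rotate_fixed_iff μ hμ (by omega) _).2 hyf, ?_⟩
      · rw [← hv]; exact (foldl_rotate_fixed_iff μ hμ (by omega) _).2 hxf
      · rw [← hv]; intro h; exact hxy (foldl_act_injective μ hμ (z.take i) h)
    · rintro ⟨z₁, x₁, y₁, i₁⟩ h₁ ⟨z₂, x₂, y₂, i₂⟩ h₂ heq
      rw [mem_coe, hAx, mem_filter] at h₁ h₂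
      simp only [Prod.mk.injEq] at heq
      obtain ⟨hi, hz, hy⟩ := heq
      subst hi
      have hz' : z₁ = z₂ := List.rotate_eq_rotate.1 hz
      subst hz'
      have hy' : y₁ = y₂ := foldl_act_injective μ hμ (z₁.take i₁) hy
      subst hy'
      have hv₁ := h₁.2
      have hv₂ := h₂.2
      dsimp only at hv₁ hv₂
      rw [foldl_act_injective μ hμ (z₁.take i₁) (hv₁.trans hv₂.symm)]
  -- the `y`-side: `(z, x, y, i) ↦ (i, z.rotate i, x · z.take i)`
  have hy : Ay.card ≤ ℓ * Pv.card := by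
    rw [← hcardPv]
    refine card_le_card_of_injOn
      (fun t => (t.2.2.2, t.1.rotate t.2.2.2, (t.1.take t.2.2.2).foldl (fun v c => μ c v) t.2.1)) ?_ ?_
    · rintro ⟨z, x, y, i⟩ h
      rw [mem_coe, hAy, mem_filter, hA, mem_filter] at h
      obtain ⟨⟨hmem, hxf, hyf, hxy, -⟩, hv⟩ := h
      simp only [mem_product, mem_univ, true_and, mem_range] at hmem
      obtain ⟨hz, hi⟩ := hmem
      dsimp only at hxf hyf hxy hv hz hi
      have hzl : z.length = ℓ := (mem_cycWords.1 hz).1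
      simp only
      rw [mem_coe, mem_product, hPv, mem_filter]
      simp only [mem_product, mem_univ, and_true, mem_range]
      refine ⟨hi, rotate_mem_cycWords hz i, ?_, (foldl_rotate_fixed_iff μ hμ (by omega) _).2 hxf, ?_⟩
      · rw [← hv]; exact (foldl_rotate_fixed_iff μ hμ (by omega) _).2 hyf
      · rw [← hv]; intro h; exact hxy (foldl_act_injective μ hμ (z.take i) h).symm
    · rintro ⟨z₁, x₁, y₁, i₁⟩ h₁ ⟨z₂, x₂, y₂, i₂⟩ h₂ heq
      rw [mem_coe, hAy, mem_filter] at h₁ h₂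
      simp only [Prod.mk.injEq] at heq
      obtain ⟨hi, hz, hx⟩ := heq
      subst hi
      have hz' : z₁ = z₂ := List.rotate_eq_rotate.1 hz
      subst hz'
      have hx' : x₁ = x₂ := foldl_act_injective μ hμ (z₁.take i₁) hx
      subst hx'
      have hv₁ := h₁.2
      have hv₂ := h₂.2
      dsimp only at hv₁ hv₂
      rw [foldl_act_injective μ hμ (z₁.take i₁) (hv₁.trans hv₂.symm)]
  calc A.card ≤ (Ax ∪ Ay).card := card_le_card hsplit
    _ ≤ Ax.card + Ay.card := card_union_le _ _
    _ ≤ ℓ * Pv.card + ℓ * Pv.card := Nat.add_le_add hx hy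
    _ = 2 * (ℓ * Pv.card) := by ring

/-- **`stub_twinsEll2BulkInc` — the twins ℓ² reduction in bulk form, incidence version** (registered `--supports` sub-goal of
crux stmt-MatrixMultiplication-10883).  At length `k + 2`: if the pre-pairs based at any vertex number `≤ Dp` and
`2·#SELF + #CROSS + 2(k+2)·(2(k+2)·Dp)·G < Pairs`, then the GOOD twin pre-pairs, read as walk data
`(t ↦ z[t], t ↦ x·z.take t, t ↦ y·z.take t)`, form a finset `W` of clean closed rung-walks (clause format of branch (B) of
`stub_oneScaleDichotomy`) of point-degree `≤ D := 2(k+2)·Dp` with `2(k+2)·D·G < |W|`. -/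
theorem stub_twinsEll2BulkInc : ∀ (n k G Dp : ℕ) (μ : Fin 3 → Equiv.Perm (Fin n)), (∀ c, μ c * μ c = 1) → (∀ v : Fin n, (((((Finset.univ : Finset (List.Vector (Fin 3) (k + 2))).image (fun v => v.toList)).filter (fun z => List.IsChain (· ≠ ·) (z ++ z))) ×ˢ (Finset.univ : Finset (Fin n))).filter (fun t => t.1.foldl (fun v c => μ c v) v = v ∧ t.1.foldl (fun v c => μ c v) t.2 = t.2 ∧ v ≠ t.2)).card ≤ Dp) → 2 * (((((Finset.univ : Finset (List.Vector (Fin 3) (k + 2))).image (fun v => v.toList)).filter (fun z => List.IsChain (· ≠ ·) (z ++ z))) ×ˢ (Finset.univ : Finset (Fin n)) ×ˢ (Finset.univ : Finset (Fin n)) ×ˢ Finset.range (k + 2) ×ˢ Finset.range (k + 2)).filter (fun t => t.1.foldl (fun v c => μ c v) t.2.1 = t.2.1 ∧ t.1.foldl (fun v c => μ c v) t.2.2.1 = t.2.2.1 ∧ t.2.1 ≠ t.2.2.1 ∧ t.2.2.2.1 < t.2.2.2.2 ∧ (t.1.take t.2.2.2.1).foldl (fun v c => μ c v) t.2.1 =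 (t.1.take t.2.2.2.2).foldl (fun v c => μ c v) t.2.1)).card + (((((Finset.univ : Finset (List.Vector (Fin 3) (k + 2))).image (fun v => v.toList)).filter (fun z => List.IsChain (· ≠ ·) (z ++ z))) ×ˢ (Finset.univ : Finset (Fin n)) ×ˢ (Finset.univ : Finset (Fin n)) ×ˢ Finset.range (k + 2) ×ˢ Finset.range (k + 2)).filter (fun t => t.1.foldl (fun v c => μ c v) t.2.1 = t.2.1 ∧ t.1.foldl (fun v c => μ c v) t.2.2.1 = t.2.2.1 ∧ t.2.1 ≠ t.2.2.1 ∧ (t.1.take t.2.2.2.1).foldl (fun v c => μ c v) t.2.1 = (t.1.take t.2.2.2.2).foldl (fun v c => μ c v) t.2.2.1)).card + 2 * (k + 2) * (2 * (k + 2) * Dp) * G < (((((Finset.univ : Finset (List.Vector (Fin 3) (k + 2))).image (fun v => v.toList)).filter (fun z => List.IsChain (· ≠ ·) (z ++ z))) ×ˢ (Finset.univ : Finset (Fin n)) ×ˢ (Finset.univ : Finset (Fin n))).filter (fun t => t.1.foldl (fun v c => μ c v) t.2.1 = t.2.1 ∧ t.1.foldl (fun v c => μ c v) t.2.2 = t.2.2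 ∧ t.2.1 ≠ t.2.2)).card → ∃ (W : Finset ((Fin (k + 2) → Fin 3) × (Fin (k + 2) → Fin n) × (Fin (k + 2) → Fin n))) (D : ℕ), (∀ w ∈ W, (∀ i, w.2.1 i ≠ w.2.2 i) ∧ (∀ i, (μ (w.1 i) (w.2.1 i) = w.2.1 (i + 1) ∧ μ (w.1 i) (w.2.2 i) = w.2.2 (i + 1)) ∨ (μ (w.1 i) (w.2.1 i) = w.2.2 (i + 1) ∧ μ (w.1 i) (w.2.2 i) = w.2.1 (i + 1))) ∧ (∀ i, w.1 i ≠ w.1 (i + 1)) ∧ (∀ i j, (w.2.1 i = w.2.1 j ∧ w.2.2 i = w.2.2 j) ∨ (w.2.1 i = w.2.2 j ∧ w.2.2 i = w.2.1 j) ∨ (w.2.1 i ≠ w.2.1 j ∧ w.2.1 i ≠ w.2.2 j ∧ w.2.2 i ≠ w.2.1 j ∧ w.2.2 i ≠ w.2.2 j))) ∧ (∀ v : Fin n, (W.filter (fun w => ∃ i, w.2.1 i = v ∨ w.2.2 i = v)).card ≤ D) ∧ 2 * (k + 2) * D * G < W.card := by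
  intro n k G Dp μ hμ hDp hcount
  classical
  -- names
  set W0 := ((univ : Finset (List.Vector (Fin 3) (k + 2))).image (fun v => v.toList)).filter
    (fun z => List.IsChain (· ≠ ·) (z ++ z)) with hW0
  set P := (W0 ×ˢ (univ : Finset (Fin n)) ×ˢ (univ : Finset (Fin n))).filter
    (fun t => t.1.foldl (fun v c => μ c v) t.2.1 = t.2.1 ∧ t.1.foldl (fun v c => μ c v) t.2.2 = t.2.2 ∧
      t.2.1 ≠ t.2.2) with hP
  set BSx := P.filter (fun t => ∃ s < k + 2, ∃ s' < k + 2, s < s' ∧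
    (t.1.take s).foldl (fun v c => μ c v) t.2.1 = (t.1.take s').foldl (fun v c => μ c v) t.2.1) with hBSx
  set BSy := P.filter (fun t => ∃ s < k + 2, ∃ s' < k + 2, s < s' ∧
    (t.1.take s).foldl (fun v c => μ c v) t.2.2 = (t.1.take s').foldl (fun v c => μ c v) t.2.2) with hBSy
  set BC := P.filter (fun t => ∃ s < k + 2, ∃ s' < k + 2,
    (t.1.take s).foldl (fun v c => μ c v) t.2.1 = (t.1.take s').foldl (fun v c => μ c v) t.2.2) with hBC
  set SelfInc := (W0 ×ˢ (univ : Finset (Fin n)) ×ˢ (univ : Finset (Fin n)) ×ˢ range (k + 2) ×ˢ range (k + 2)).filter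
    (fun t => t.1.foldl (fun v c => μ c v) t.2.1 = t.2.1 ∧ t.1.foldl (fun v c => μ c v) t.2.2.1 = t.2.2.1 ∧
      t.2.1 ≠ t.2.2.1 ∧ t.2.2.2.1 < t.2.2.2.2 ∧
      (t.1.take t.2.2.2.1).foldl (fun v c => μ c v) t.2.1 = (t.1.take t.2.2.2.2).foldl (fun v c => μ c v) t.2.1)
    with hSelfInc
  set CrossInc := (W0 ×ˢ (univ : Finset (Fin n)) ×ˢ (univ : Finset (Fin n)) ×ˢ range (k + 2) ×ˢ range (k + 2)).filter
    (fun t => t.1.foldl (fun v c => μ c v) t.2.1 = t.2.1 ∧ t.1.foldl (fun v c => μ c v) t.2.2.1 = t.2.2.1 ∧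
      t.2.1 ≠ t.2.2.1 ∧
      (t.1.take t.2.2.2.1).foldl (fun v c => μ c v) t.2.1 = (t.1.take t.2.2.2.2).foldl (fun v c => μ c v) t.2.2.1)
    with hCrossInc
  set Good := P \ (BSx ∪ BSy ∪ BC) with hGood
  -- (1) defect counts
  have h1 : BSx.card ≤ SelfInc.card := by
    refine card_le_card_of_surjOn (fun a => (a.1, a.2.1, a.2.2.1)) ?_
    rintro ⟨z, x, y⟩ h
    rw [mem_coe, hBSx, mem_filter, hP, mem_filter] at h
    obtain ⟨⟨hmem, hx, hy, hxy⟩, s, hs, s', hs', hss', hcoin⟩ := h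
    simp only [mem_product, mem_univ, and_true] at hmem
    refine ⟨(z, x, y, s, s'), ?_, rfl⟩
    rw [mem_coe, hSelfInc, mem_filter]
    simp only [mem_product, mem_univ, true_and, mem_range]
    exact ⟨⟨hmem, hs, hs'⟩, hx, hy, hxy, hss', hcoin⟩
  have h2 : BC.card ≤ CrossInc.card := by
    refine card_le_card_of_surjOn (fun a => (a.1, a.2.1, a.2.2.1)) ?_
    rintro ⟨z, x, y⟩ h
    rw [mem_coe, hBC, mem_filter, hP, mem_filter] at h
    obtain ⟨⟨hmem, hx, hy, hxy⟩, s, hs, s', hs', hcoin⟩ := h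
    simp only [mem_product, mem_univ, and_true] at hmem
    refine ⟨(z, x, y, s, s'), ?_, rfl⟩
    rw [mem_coe, hCrossInc, mem_filter]
    simp only [mem_product, mem_univ, true_and, mem_range]
    exact ⟨⟨hmem, hs, hs'⟩, hx, hy, hxy, hcoin⟩
  have h4 : BSy.card ≤ BSx.card := by
    refine card_le_card_of_injOn (fun a => (a.1, a.2.2, a.2.1)) ?_ ?_
    · rintro ⟨z, x, y⟩ h
      rw [mem_coe, hBSy, mem_filter, hP, mem_filter] at h
      obtain ⟨⟨hmem, hx, hy, hxy⟩, hex⟩ := h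
      simp only [mem_product, mem_univ, and_true] at hmem
      rw [mem_coe, hBSx, mem_filter, hP, mem_filter]
      simp only [mem_product, mem_univ, and_true]
      exact ⟨⟨hmem, hy, hx, fun h => hxy h.symm⟩, hex⟩
    · rintro ⟨z₁, x₁, y₁⟩ - ⟨z₂, x₂, y₂⟩ - h
      simp only [Prod.mk.injEq] at h
      obtain ⟨rfl, rfl, rfl⟩ := h
      rfl
  -- (2) many good pre-pairs
  have hGoodCard : 2 * (k + 2) * (2 * (k + 2) * Dp) * G < Good.card := by
    have hc : 2 * SelfInc.card + CrossInc.card + 2 * (k + 2) * (2 * (k + 2) * Dp) * G < P.card := hcount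
    have hle : P.card ≤ Good.card + (BSx ∪ BSy ∪ BC).card := card_le_card_sdiff_add_card
    have hU : (BSx ∪ BSy ∪ BC).card ≤ BSx.card + BSy.card + BC.card :=
      (card_union_le _ _).trans (Nat.add_le_add_right (card_union_le _ _) _)
    have hB : BSx.card + BSy.card + BC.card ≤ 2 * SelfInc.card + CrossInc.card := by
      have := Nat.add_le_add (Nat.add_le_add h1 (h4.trans h1)) h2
      omega
    omega
  -- (3) goodness, unpacked
  have goodP : ∀ {z : List (Fin 3)} {x y : Fin n}, ((z, x, y) : List (Fin 3) × Fin n × Fin n) ∈ Good →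
      (z.length = k + 2 ∧ List.IsChain (· ≠ ·) (z ++ z)) ∧ z.foldl (fun v c => μ c v) x = x ∧
        z.foldl (fun v c => μ c v) y = y ∧ x ≠ y := by
    intro z x y hg
    rw [hGood, mem_sdiff, hP, mem_filter] at hg
    obtain ⟨⟨hmem, hx, hy, hxy⟩, -⟩ := hg
    simp only [mem_product, mem_univ, and_true] at hmem
    exact ⟨mem_cycWords.1 hmem, hx, hy, hxy⟩
  have goodX : ∀ {z : List (Fin 3)} {x y : Fin n}, ((z, x, y) : List (Fin 3) × Fin n × Fin n) ∈ Good →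
      ∀ s < z.length, ∀ t < z.length,
        (z.take s).foldl (fun v c => μ c v) x = (z.take t).foldl (fun v c => μ c v) x → s = t := by
    intro z x y hg s hs t ht h
    have hzl := (goodP hg).1.1
    have hg' := hg
    rw [hGood, mem_sdiff] at hg'
    obtain ⟨hPm, hnot⟩ := hg'
    simp only [mem_union, not_or] at hnot
    by_contra hst
    rcases Nat.lt_or_gt_of_ne hst with hlt | hlt
    · exact hnot.1.1 (by rw [hBSx, mem_filter]; exact ⟨hPm, s, by omega, t, by omega, hlt, h⟩)
    · exact hnot.1.1 (by rw [hBSx, mem_filter]; exact ⟨hPm, t, by omega, s, by omega, hlt, h.symm⟩)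
  have goodY : ∀ {z : List (Fin 3)} {x y : Fin n}, ((z, x, y) : List (Fin 3) × Fin n × Fin n) ∈ Good →
      ∀ s < z.length, ∀ t < z.length,
        (z.take s).foldl (fun v c => μ c v) y = (z.take t).foldl (fun v c => μ c v) y → s = t := by
    intro z x y hg s hs t ht h
    have hzl := (goodP hg).1.1
    have hg' := hg
    rw [hGood, mem_sdiff] at hg'
    obtain ⟨hPm, hnot⟩ := hg'
    simp only [mem_union, not_or] at hnot
    by_contra hst
    rcases Nat.lt_or_gt_of_ne hst with hlt | hlt
    · exact hnot.1.2 (by rw [hBSy, mem_filter]; exact ⟨hPm, s, by omega, t, by omega, hlt, h⟩)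
    · exact hnot.1.2 (by rw [hBSy, mem_filter]; exact ⟨hPm, t, by omega, s, by omega, hlt, h.symm⟩)
  have goodC : ∀ {z : List (Fin 3)} {x y : Fin n}, ((z, x, y) : List (Fin 3) × Fin n × Fin n) ∈ Good →
      ∀ s < z.length, ∀ t < z.length,
        (z.take s).foldl (fun v c => μ c v) x ≠ (z.take t).foldl (fun v c => μ c v) y := by
    intro z x y hg s hs t ht h
    have hzl := (goodP hg).1.1
    have hg' := hg
    rw [hGood, mem_sdiff] at hg'
    obtain ⟨hPm, hnot⟩ := hg'
    simp only [mem_union, not_or] at hnot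
    exact hnot.2 (by rw [hBC, mem_filter]; exact ⟨hPm, s, by omega, t, by omega, h⟩)
  -- (4) the walk data map and its injectivity on `Good`
  let T : List (Fin 3) × Fin n × Fin n → (Fin (k + 2) → Fin 3) × (Fin (k + 2) → Fin n) × (Fin (k + 2) → Fin n) :=
    fun t => (fun i => t.1.getD i 0, fun i => (t.1.take i).foldl (fun v c => μ c v) t.2.1,
      fun i => (t.1.take i).foldl (fun v c => μ c v) t.2.2)
  have hTinj : Set.InjOn T ↑Good := by
    rintro ⟨z₁, x₁, y₁⟩ h₁ ⟨z₂, x₂, y₂⟩ h₂ heq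
    have hl₁ := (goodP (mem_coe.1 h₁)).1.1
    have hl₂ := (goodP (mem_coe.1 h₂)).1.1
    simp only [T, Prod.mk.injEq] at heq
    obtain ⟨hz, hx, hy⟩ := heq
    have hx0 := congrFun hx 0
    have hy0 := congrFun hy 0
    simp only [Fin.val_zero, List.take_zero, List.foldl_nil] at hx0 hy0
    have hz' : z₁ = z₂ := by
      refine List.ext_getElem (by rw [hl₁, hl₂]) fun i hi₁ hi₂ => ?_
      have := congrFun hz ⟨i, by omega⟩
      simp only at this
      rwa [List.getD_eq_getElem z₁ 0 hi₁, List.getD_eq_getElem z₂ 0 hi₂] at this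
    rw [hz', hx0, hy0]
  refine ⟨Good.image T, 2 * (k + 2) * Dp, ?_, ?_, ?_⟩
  · -- clauses
    intro w hw
    obtain ⟨⟨z, x, y⟩, hg, rfl⟩ := mem_image.1 hw
    obtain ⟨⟨hzl, hchain⟩, hx, hy, -⟩ := goodP hg
    exact walkData_clauses μ hzl hchain hx hy (goodX hg) (goodY hg) (goodC hg)
  · -- degree
    intro v
    rw [filter_image]
    refine card_image_le.trans ?_
    refine (card_le_card_of_surjOn (fun a => (a.1, a.2.1, a.2.2.1)) ?_).trans
      ((card_through_le μ hμ (k + 2) v).trans ?_)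
    · rintro ⟨z, x, y⟩ h
      rw [mem_coe, mem_filter] at h
      obtain ⟨hg, i, hi⟩ := h
      obtain ⟨⟨hzl, hchain⟩, hx, hy, hxy⟩ := goodP hg
      have hmem : z ∈ W0 := mem_cycWords.2 ⟨hzl, hchain⟩
      refine ⟨(z, x, y, (i : ℕ)), ?_, rfl⟩
      rw [mem_coe, mem_filter]
      simp only [mem_product, mem_univ, true_and, mem_range]
      exact ⟨⟨hmem, i.isLt⟩, hx, hy, hxy, hi⟩
    · have := hDp v
      calc 2 * ((k + 2) * _) ≤ 2 * ((k + 2) * Dp) := by gcongr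
        _ = 2 * (k + 2) * Dp := by ring
  · -- count
    rw [card_image_of_injOn hTinj]
    exact hGoodCard

end TwinsEll2

end Summit.MatrixMultiplication.MatrixMultiplication.Theorems.HyperoctahedralThreshold
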